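import Summits.QuantumFields.BalabanUV.Beta.GAN24.FaceWordCellPairingDeep
import Summits.QuantumFields.BalabanUV.Beta.GAN24.RespGaugeStencil

/-!
# `BalabanUV.Beta.GAN24.FaceWordNullSector` — binder row G-an2-4 ∕ (CONV-C), W-slot (α-0), typer's PART VI row **T6-VAL**, the (γ) hand's letters **K7-a ∕ K7-0, THE SECTOR SPLIT
# (α) OF THE ADAPTER**: **THE DIRECT EXCHANGE FACE WORD OF A FINE TABLE `S = S₁ + S₂` WHOSE SECOND SECTOR HAS NULL TWO-FACE CURRENTS IS THE CELL PAIRING OF THE FIRST SECTOR's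
# CURRENTS** — this lineage's junction `FaceWordCellPairingDeep.faceWord_eq_cellPairing` (g56) GENERALISED: the field-legs-only hypothesis is asked of `S₁` only, and of `S₂` only that
# its period-`N` two-face currents vanish in both leg positions (`hnullL`: weighted leg first, free leg `(x, f)` second; `hnullR`: free leg `(z, g)` first, weighted leg second — the two
# shapes of this lineage's `FaceDataVHNull.vhSAt_faceData_eq_zero ∕ _zero'`, p382934): then
# `Σ_{rr∈box N} Σ'_t χ_N(rr_μ)χ_N(t_ν)·Σ'_{(y,w)} χ_N(y_α)χ_N(w_β)·((S μ rr ∘ X) ∘ S ν t)(y,w)(inl α)(inl β) = Σ_{x∈box N} Σ_a FF¹_L(a,x)·Σ'_z Σ_b X(x,z)_{ab}·FF¹_R(b,z)` with the currents of `S₁`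
# — so road-P2's E⊗VH, VH⊗E, VH⊗VH face words never have to be formed: the FULL fine table `S♮_j = S^E + S^VH` goes in, the E-sector cell pairing (g56 `FaceWordEEValueDeep` ∕ g57
# `FaceWordEEValueZero`) comes out (G-an2-4 CRUX TEAM (2), seat `b2b-balaban-gan24-formalise-leaf-06` = the (γ) hand, gen 57; journal [GAN24LEAF06-G57-INTENT-5])

NOT IN PRINT; OUR BOOKKEEPING ([folklore] the TEXT of g56's `faceWord_eq_cellPairing` through its Step 3 (generic in `S`: Part 42 `nested_eq_facePairing`, leaf-04 `fubini3`, K4a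
`sum_box_tsum_swap_weight`, `FaceWordCurrentsDeep`), then linearity of the left single-bond current and of the right two-face current in `S` (summability from `LocStencil S₁`, `LocStencil S₂`:
`summable_leftCurrent ∕ abs_leftCurrent_le ∕ tsum_leftCurrent_eq_faceL`, `RespGaugeStencil.summable_faceStencil_slot ∕ decays_faceStencil`) and the two null hypotheses; 0 `def`,
0 cited fact, 0 `def … : Prop`, 0 sorry).  HONEST FRAMING (cell contract, verbatim): «discharging `BetaPertH` makes Bałaban's UV stability UNCONDITIONAL — a real constructive-QFT result;
it is NOT the continuum limit and NOT the Clay problem.»  HONEST DEPENDENCY (verbatim): «continuum YM on T⁴ ⇐ BetaPertH ∧ nine spine estimates (0/9 proved); BetaPertH ⇐ (D1) ∧ (D4) ∧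
CAP+tail; G-an2-4 gates asym, D1 and NE2/3/4.»

WHAT ([folklore]; hypotheses: `hS : LocStencil S Cs δ`, `hS₁ : LocStencil S₁ Cs₁ δ`, `hS₂ : LocStencil S₂ Cs₂ δ`, `hX : Decays X CX δ`, `hδ : 0 < δ`, `hSt` (`N`-covariance of `S`), `hXt`,
`hsplit : ∀ κ t, S κ t = S₁ κ t + S₂ κ t`, `hS₁l ∕ hS₁r` (field legs only, `S₁`), `hnullL ∕ hnullR` (null two-face currents of `S₂`)): §1 linearity tools (`leftCurrent_add`, `faceR_add`,
`summable_chi_leftCurrent`, `summable_chi_faceSlot`); §2 **`faceWord_eq_cellPairing_of_null`**.  Asserts NO value of any table; discharges NOTHING of `hX` ∕ `hXu` ∕ (C)_{≥1} ∕ `hB0` ∕ `hBF`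
∕ (Q-L); NEVER «G-an2-4 closed» as (CONV-C); NOT D1, NOT `BetaPertH`, NOT continuum, NOT Clay.  2026-08-24; no existing file touched.
-/

noncomputable section

open Finset
open scoped BigOperators
open Literature.MathematicalPhysics.QuantumFieldTheory
open Literature.MathematicalPhysics.QuantumFieldTheory.Balaban1983to89
open Literature.MathematicalPhysics.QuantumFieldTheory.Balaban1983to89.Beta
open B12Sec2to5 (l1 l1_nonneg)
open ExpKernelCalculus (Site MKer Decays BiLoc shiftK comp Zl Zl_pos Zl_nonneg summable_exp_shift summable_exp_shift' tsum_exp_shift tsum_exp_shift' l1_sub_symm)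
open OneStepResolventKernel (Fib LocStencil)
open AffineAveraging (box toSite)
open Summit.QuantumFields.BalabanUV.Beta.GAN24.PairingCellTransfer (nested_eq_facePairing ite_eq_mask_mul)
open Summit.QuantumFields.BalabanUV.Beta.GAN24.JointPeriodicCellSwap (sum_box_tsum_swap_weight)
open Summit.QuantumFields.BalabanUV.Beta.GAN24.EEWordValue (fubini3)
open Summit.QuantumFields.BalabanUV.Beta.GAN24.FaceWordCurrentsDeep (faceR_mask_eq abs_faceR_le faceR_periodic summable_leftCurrent abs_leftCurrent_le leftCurrent_cov
  tsum_leftCurrent_eq_faceL)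
open Summit.QuantumFields.BalabanUV.Beta.GAN24.FaceWordCellPairingDeep (abs_applyR_le applyR_periodic word_bond_eq)
open Summit.QuantumFields.BalabanUV.Beta.GAN24.RespGaugeStencil (decays_faceStencil summable_faceStencil_slot)

namespace Summit.QuantumFields.BalabanUV.Beta.GAN24.FaceWordNullSector

variable {d : ℕ} {N : ℕ} [NeZero N]
variable {S S₁ S₂ : Fin (d + 1) → Site (d + 1) → MKer (d + 1) (Fib d)} {X : MKer (d + 1) (Fib d)} {Cs Cs₁ Cs₂ CX δ : ℝ}

/-! ## §1 Linearity of the two currents in the table -/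

omit [NeZero N] in
/-- [folklore] The `v`-series of the masked left single-bond current of a local stencil family is summable (free leg `(x, f)` fixed). -/
theorem summable_chi_leftCurrent (hS : LocStencil S Cs δ) (hδ : 0 < δ) (μ α : Fin (d + 1)) (x : Site (d + 1)) (f : Fib d) :
    Summable fun v : Site (d + 1) => (if v μ % (N : ℤ) = (N : ℤ) - 1 then (1 : ℝ) else 0) *
      ∑' y : Site (d + 1), (if y α % (N : ℤ) = (N : ℤ) - 1 then (1 : ℝ) else 0) * S μ v y x (Sum.inl α) f := by
  have hCs : 0 ≤ Cs := (hS 0 0).nonneg (Sum.inl 0)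
  refine Summable.of_norm_bounded ((summable_exp_shift hδ x).mul_left (Cs * Zl (d + 1) δ)) fun v => ?_
  rw [Real.norm_eq_abs, abs_mul]
  have h1 : |(if v μ % (N : ℤ) = (N : ℤ) - 1 then (1 : ℝ) else 0)| ≤ 1 := by split_ifs <;> simp
  calc |(if v μ % (N : ℤ) = (N : ℤ) - 1 then (1 : ℝ) else 0)| * |∑' y : Site (d + 1), (if y α % (N : ℤ) = (N : ℤ) - 1 then (1 : ℝ) else 0) * S μ v y x (Sum.inl α) f|
      ≤ 1 * (Cs * Zl (d + 1) δ * Real.exp (-δ * l1 (x - v))) := mul_le_mul h1 (abs_leftCurrent_le (N := N) hS hδ μ α v x f) (abs_nonneg _) zero_le_one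
    _ = _ := by ring

omit [NeZero N] in
/-- [folklore] **THE LEFT SINGLE-BOND CURRENT IS ADDITIVE IN THE TABLE**: for `S = S₁ + S₂` slotwise,
`Σ'_y χ(y_α)·S μ v y x (inl α) f = Σ'_y χ(y_α)·S₁ μ v y x (inl α) f + Σ'_y χ(y_α)·S₂ μ v y x (inl α) f`. -/
theorem leftCurrent_add (hS₁ : LocStencil S₁ Cs₁ δ) (hS₂ : LocStencil S₂ Cs₂ δ) (hδ : 0 < δ)
    (hsplit : ∀ (κ : Fin (d + 1)) (t : Site (d + 1)), S κ t = S₁ κ t + S₂ κ t) (μ α : Fin (d + 1)) (v x : Site (d + 1)) (f : Fib d) :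
    (∑' y : Site (d + 1), (if y α % (N : ℤ) = (N : ℤ) - 1 then (1 : ℝ) else 0) * S μ v y x (Sum.inl α) f) =
      (∑' y : Site (d + 1), (if y α % (N : ℤ) = (N : ℤ) - 1 then (1 : ℝ) else 0) * S₁ μ v y x (Sum.inl α) f) +
        ∑' y : Site (d + 1), (if y α % (N : ℤ) = (N : ℤ) - 1 then (1 : ℝ) else 0) * S₂ μ v y x (Sum.inl α) f := by
  rw [← (summable_leftCurrent (N := N) hS₁ hδ μ α v x f).tsum_add (summable_leftCurrent (N := N) hS₂ hδ μ α v x f)]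
  refine tsum_congr fun y => ?_
  rw [hsplit, Pi.add_apply, Pi.add_apply, Pi.add_apply, Pi.add_apply, mul_add]

omit [NeZero N] in
/-- [folklore] The `w`-series of the masked face-gated slot sum of a local stencil family is summable (free leg `(z, g)` fixed). -/
theorem summable_chi_faceSlot (hS : LocStencil S Cs δ) (hδ : 0 < δ) (ν β : Fin (d + 1)) (z : Site (d + 1)) (g b : Fib d) :
    Summable fun w : Site (d + 1) => (if w β % (N : ℤ) = (N : ℤ) - 1 then (1 : ℝ) else 0) *
      ∑' t : Site (d + 1), (if t ν % (N : ℤ) = (N : ℤ) - 1 then S ν t z w g b else 0) := by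
  have hD := decays_faceStencil (N := N) hS hδ ν
  have h1 : ∀ w : Site (d + 1), |(if w β % (N : ℤ) = (N : ℤ) - 1 then (1 : ℝ) else 0)| ≤ 1 := fun w => by split_ifs <;> simp
  exact KKTFluctuationEnergy.summable_mul_of_bdd h1 (AxialDressing.summable_row_of_decays hD (half_pos hδ) z g b)

omit [NeZero N] in
/-- [folklore] **THE RIGHT TWO-FACE CURRENT IS ADDITIVE IN THE TABLE** (`if`-spelling, free leg `(z, g)` first). -/
theorem faceR_add (hS₁ : LocStencil S₁ Cs₁ δ) (hS₂ : LocStencil S₂ Cs₂ δ) (hδ : 0 < δ)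
    (hsplit : ∀ (κ : Fin (d + 1)) (t : Site (d + 1)), S κ t = S₁ κ t + S₂ κ t) (ν β : Fin (d + 1)) (z : Site (d + 1)) (g b : Fib d) :
    (∑' w : Site (d + 1), (if w β % (N : ℤ) = (N : ℤ) - 1 then (1 : ℝ) else 0) * ∑' t : Site (d + 1), (if t ν % (N : ℤ) = (N : ℤ) - 1 then S ν t z w g b else 0)) =
      (∑' w : Site (d + 1), (if w β % (N : ℤ) = (N : ℤ) - 1 then (1 : ℝ) else 0) * ∑' t : Site (d + 1), (if t ν % (N : ℤ) = (N : ℤ) - 1 then S₁ ν t z w g b else 0)) +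
        ∑' w : Site (d + 1), (if w β % (N : ℤ) = (N : ℤ) - 1 then (1 : ℝ) else 0) * ∑' t : Site (d + 1), (if t ν % (N : ℤ) = (N : ℤ) - 1 then S₂ ν t z w g b else 0) := by
  rw [← (summable_chi_faceSlot (N := N) hS₁ hδ ν β z g b).tsum_add (summable_chi_faceSlot (N := N) hS₂ hδ ν β z g b)]
  refine tsum_congr fun w => ?_
  rw [← mul_add, ← (summable_faceStencil_slot (N := N) hS₁ hδ ν z w g b).tsum_add (summable_faceStencil_slot (N := N) hS₂ hδ ν z w g b)]
  congr 1
  refine tsum_congr fun t => ?_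
  split_ifs
  · rw [hsplit, Pi.add_apply, Pi.add_apply, Pi.add_apply, Pi.add_apply]
  · rw [add_zero]

/-! ## §2 The face word of a table with a null sector -/

/-- NOT IN PRINT; OUR BOOKKEEPING.  **THE DIRECT EXCHANGE FACE WORD OF `S = S₁ + S₂` WITH `S₂`'s TWO-FACE CURRENTS NULL IS THE CELL PAIRING OF `S₁`'s CURRENTS** (module docstring). -/
theorem faceWord_eq_cellPairing_of_null (hS : LocStencil S Cs δ) (hS₁ : LocStencil S₁ Cs₁ δ) (hS₂ : LocStencil S₂ Cs₂ δ) (hX : Decays X CX δ) (hδ : 0 < δ)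
    (hSt : ∀ (κ : Fin (d + 1)) (t s : Site (d + 1)), S κ (t + (N : ℤ) • s) = shiftK (-((N : ℤ) • s)) (S κ t))
    (hXt : ∀ s : Site (d + 1), shiftK (-((N : ℤ) • s)) X = X)
    (hsplit : ∀ (κ : Fin (d + 1)) (t : Site (d + 1)), S κ t = S₁ κ t + S₂ κ t)
    (hS₁l : ∀ (κ : Fin (d + 1)) (t y x : Site (d + 1)) (m : Fin (d + 1)) (b : Fib d), S₁ κ t y x (Sum.inr m) b = 0)
    (hS₁r : ∀ (κ : Fin (d + 1)) (t y x : Site (d + 1)) (a : Fib d) (m : Fin (d + 1)), S₁ κ t y x a (Sum.inr m) = 0)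
    (μ ν α β : Fin (d + 1))
    (hnullL : ∀ (x : Site (d + 1)) (f : Fib d), (∑' y : Site (d + 1), (if y α % (N : ℤ) = (N : ℤ) - 1 then (1 : ℝ) else 0) *
      ∑' t : Site (d + 1), (if t μ % (N : ℤ) = (N : ℤ) - 1 then S₂ μ t y x (Sum.inl α) f else 0)) = 0)
    (hnullR : ∀ (z : Site (d + 1)) (g : Fib d), (∑' w : Site (d + 1), (if w β % (N : ℤ) = (N : ℤ) - 1 then (1 : ℝ) else 0) *
      ∑' t : Site (d + 1), (if t ν % (N : ℤ) = (N : ℤ) - 1 then S₂ ν t z w g (Sum.inl β) else 0)) = 0) :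
    ∑ rr ∈ box (d + 1) N, ∑' t : Site (d + 1), (if toSite rr μ % (N : ℤ) = (N : ℤ) - 1 then (1 : ℝ) else 0) * (if t ν % (N : ℤ) = (N : ℤ) - 1 then (1 : ℝ) else 0) *
        ∑' yw : Site (d + 1) × Site (d + 1), (if yw.1 α % (N : ℤ) = (N : ℤ) - 1 then (1 : ℝ) else 0) * (if yw.2 β % (N : ℤ) = (N : ℤ) - 1 then (1 : ℝ) else 0) *
          comp (comp (S μ (toSite rr)) X) (S ν t) yw.1 yw.2 (Sum.inl α) (Sum.inl β) =
      ∑ x ∈ box (d + 1) N, ∑ a : Fin (d + 1),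
        (∑' y : Site (d + 1), (if y α % (N : ℤ) = (N : ℤ) - 1 then (1 : ℝ) else 0) *
          ∑' t : Site (d + 1), (if t μ % (N : ℤ) = (N : ℤ) - 1 then S₁ μ t y (toSite x) (Sum.inl α) (Sum.inl a) else 0)) *
        (∑' z : Site (d + 1), ∑ b : Fin (d + 1), X (toSite x) z (Sum.inl a) (Sum.inl b) *
          (∑' w : Site (d + 1), (if w β % (N : ℤ) = (N : ℤ) - 1 then (1 : ℝ) else 0) *
            ∑' t : Site (d + 1), (if t ν % (N : ℤ) = (N : ℤ) - 1 then S₁ ν t z w (Sum.inl b) (Sum.inl β) else 0))) := by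
  classical
  have hCs : 0 ≤ Cs := (hS 0 0).nonneg (Sum.inl 0)
  have hCX : 0 ≤ CX := hX.nonneg (Sum.inl 0)
  -- Part 42's spelling of the right current `R`, its bound and periodicity
  set R : Fib d → Site (d + 1) → ℝ := fun g z => ∑' w : Site (d + 1), (if w β % (N : ℤ) = (N : ℤ) - 1 then (1 : ℝ) else 0) *
    ((1 : ℝ) * ∑' t : Site (d + 1), (if t ν % (N : ℤ) = (N : ℤ) - 1 then (1 : ℝ) else 0) * S ν t z w g (Sum.inl β)) with hRdef
  have hReq : ∀ g z, R g z = ∑' w : Site (d + 1), (if w β % (N : ℤ) = (N : ℤ) - 1 then (1 : ℝ) else 0) *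
      ∑' t : Site (d + 1), (if t ν % (N : ℤ) = (N : ℤ) - 1 then S ν t z w g (Sum.inl β) else 0) := fun g z => faceR_mask_eq (N := N) ν β z g (Sum.inl β)
  have hRb : ∀ g z, |R g z| ≤ Cs * Zl (d + 1) (δ / 2) * Zl (d + 1) (δ / 2) := fun g z => by
    rw [hReq]; exact abs_faceR_le (N := N) hS hδ ν β z g (Sum.inl β)
  have hRp : ∀ g z s, R g (z + (N : ℤ) • s) = R g z := fun g z s => by
    rw [hReq, hReq]; exact faceR_periodic (N := N) hSt ν β z s g (Sum.inl β)
  -- the left single-bond current `L v f x` and the two-slot family `G`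
  set L : Site (d + 1) → Fib d → Site (d + 1) → ℝ := fun v f x =>
    ∑' y : Site (d + 1), (if y α % (N : ℤ) = (N : ℤ) - 1 then (1 : ℝ) else 0) * S μ v y x (Sum.inl α) f with hLdef
  set A : Fib d → Site (d + 1) → ℝ := fun f x => ∑' z : Site (d + 1), ∑ g : Fib d, X x z f g * R g z with hAdef
  set G : Site (d + 1) → Site (d + 1) → ℝ := fun v x => ∑ f : Fib d, L v f x * A f x with hGdef
  have hAb : ∀ f x, |A f x| ≤ (Fintype.card (Fib d) : ℝ) * (CX * (Cs * Zl (d + 1) (δ / 2) * Zl (d + 1) (δ / 2))) * Zl (d + 1) δ :=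
    fun f x => abs_applyR_le hX hδ hRb x f
  have hAp : ∀ f x s, A f (x + (N : ℤ) • s) = A f x := fun f x s => applyR_periodic (N := N) hXt hRp x s f
  have hLb : ∀ v f x, |L v f x| ≤ Cs * Zl (d + 1) δ * Real.exp (-δ * l1 (x - v)) := fun v f x => abs_leftCurrent_le (N := N) hS hδ μ α v x f
  have hLc : ∀ v f x s, L (v + (N : ℤ) • s) f (x + (N : ℤ) • s) = L v f x := fun v f x s => leftCurrent_cov (N := N) hSt μ α v x s f
  -- Step 1: per bond, the word is `Σ'_x G rr x`
  have step1 : ∀ rr : Fin (d + 1) → ℕ,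
      (∑' t : Site (d + 1), (if toSite rr μ % (N : ℤ) = (N : ℤ) - 1 then (1 : ℝ) else 0) * (if t ν % (N : ℤ) = (N : ℤ) - 1 then (1 : ℝ) else 0) *
        ∑' yw : Site (d + 1) × Site (d + 1), (if yw.1 α % (N : ℤ) = (N : ℤ) - 1 then (1 : ℝ) else 0) * (if yw.2 β % (N : ℤ) = (N : ℤ) - 1 then (1 : ℝ) else 0) *
          comp (comp (S μ (toSite rr)) X) (S ν t) yw.1 yw.2 (Sum.inl α) (Sum.inl β)) =
      (if toSite rr μ % (N : ℤ) = (N : ℤ) - 1 then (1 : ℝ) else 0) * ∑' x : Site (d + 1), (1 : ℝ) * G (toSite rr) x := by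
    intro rr
    have e : (fun t : Site (d + 1) => (if toSite rr μ % (N : ℤ) = (N : ℤ) - 1 then (1 : ℝ) else 0) * (if t ν % (N : ℤ) = (N : ℤ) - 1 then (1 : ℝ) else 0) *
        ∑' yw : Site (d + 1) × Site (d + 1), (if yw.1 α % (N : ℤ) = (N : ℤ) - 1 then (1 : ℝ) else 0) * (if yw.2 β % (N : ℤ) = (N : ℤ) - 1 then (1 : ℝ) else 0) *
          comp (comp (S μ (toSite rr)) X) (S ν t) yw.1 yw.2 (Sum.inl α) (Sum.inl β)) =
        fun t : Site (d + 1) => (if toSite rr μ % (N : ℤ) = (N : ℤ) - 1 then (1 : ℝ) else 0) * ((if t ν % (N : ℤ) = (N : ℤ) - 1 then (1 : ℝ) else 0) *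
        ∑' yw : Site (d + 1) × Site (d + 1), (if yw.1 α % (N : ℤ) = (N : ℤ) - 1 then (1 : ℝ) else 0) * (if yw.2 β % (N : ℤ) = (N : ℤ) - 1 then (1 : ℝ) else 0) *
          comp (comp (S μ (toSite rr)) X) (S ν t) yw.1 yw.2 (Sum.inl α) (Sum.inl β)) := by
      funext t; ring
    rw [e, tsum_mul_left, word_bond_eq (N := N) hS hX hδ μ ν α β (toSite rr)]
    congr 1
    refine tsum_congr fun x => ?_
    simp only [hGdef, hLdef, hAdef, hRdef, one_mul]
  rw [Finset.sum_congr rfl fun rr _ => step1 rr]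
  -- Step 2: K4a moves the cell from the bond `rr` to the pairing site `x`
  have hGcov : ∀ (v x s : Site (d + 1)), G (v + (N : ℤ) • s) (x + (N : ℤ) • s) = G v x := by
    intro v x s
    simp only [hGdef, hLc, hAp]
  have hGb : ∀ v x, |G v x| ≤ (Fintype.card (Fib d) : ℝ) * ((Cs * Zl (d + 1) δ) *
      ((Fintype.card (Fib d) : ℝ) * (CX * (Cs * Zl (d + 1) (δ / 2) * Zl (d + 1) (δ / 2))) * Zl (d + 1) δ)) * Real.exp (-δ * l1 (x - v)) := by
    intro v x
    calc |G v x| ≤ ∑ f : Fib d, |L v f x * A f x| := Finset.abs_sum_le_sum_abs _ _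
      _ ≤ ∑ _f : Fib d, ((Cs * Zl (d + 1) δ) * ((Fintype.card (Fib d) : ℝ) * (CX * (Cs * Zl (d + 1) (δ / 2) * Zl (d + 1) (δ / 2))) * Zl (d + 1) δ)) *
            Real.exp (-δ * l1 (x - v)) := Finset.sum_le_sum fun f _ => by
          rw [abs_mul]
          have h0 : 0 ≤ (Fintype.card (Fib d) : ℝ) * (CX * (Cs * Zl (d + 1) (δ / 2) * Zl (d + 1) (δ / 2))) * Zl (d + 1) δ := by
            have := (Zl_pos (D := d + 1) (half_pos hδ)).le; have := (Zl_pos (D := d + 1) hδ).le; positivity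
          calc |L v f x| * |A f x| ≤ (Cs * Zl (d + 1) δ * Real.exp (-δ * l1 (x - v))) *
                ((Fintype.card (Fib d) : ℝ) * (CX * (Cs * Zl (d + 1) (δ / 2) * Zl (d + 1) (δ / 2))) * Zl (d + 1) δ) :=
                mul_le_mul (hLb v f x) (hAb f x) (abs_nonneg _) (by have := (Zl_pos (D := d + 1) hδ).le; positivity)
            _ = _ := by ring
      _ = _ := by rw [Finset.sum_const, Finset.card_univ, nsmul_eq_mul]; ring
  have hGa : ∀ v : Site (d + 1), Summable fun x : Site (d + 1) => (fun _ : Site (d + 1) => (1 : ℝ)) x * G v x := by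
    intro v
    refine Summable.of_norm_bounded ((summable_exp_shift' hδ v).mul_left ((Fintype.card (Fib d) : ℝ) * ((Cs * Zl (d + 1) δ) *
      ((Fintype.card (Fib d) : ℝ) * (CX * (Cs * Zl (d + 1) (δ / 2) * Zl (d + 1) (δ / 2))) * Zl (d + 1) δ)))) fun x => ?_
    simp only [Real.norm_eq_abs, one_mul]
    exact hGb v x
  have hGbs : ∀ x : Site (d + 1), Summable fun v : Site (d + 1) => (if v μ % (N : ℤ) = (N : ℤ) - 1 then (1 : ℝ) else 0) * G v x := by
    intro x
    refine Summable.of_norm_bounded ((summable_exp_shift hδ x).mul_left ((Fintype.card (Fib d) : ℝ) * ((Cs * Zl (d + 1) δ) *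
      ((Fintype.card (Fib d) : ℝ) * (CX * (Cs * Zl (d + 1) (δ / 2) * Zl (d + 1) (δ / 2))) * Zl (d + 1) δ)))) fun v => ?_
    rw [Real.norm_eq_abs, abs_mul]
    have h1 : |(if v μ % (N : ℤ) = (N : ℤ) - 1 then (1 : ℝ) else 0)| ≤ 1 := by split_ifs <;> simp
    calc |(if v μ % (N : ℤ) = (N : ℤ) - 1 then (1 : ℝ) else 0)| * |G v x| ≤ 1 * _ := mul_le_mul h1 (hGb v x) (abs_nonneg _) zero_le_one
      _ = _ := one_mul _
  rw [sum_box_tsum_swap_weight (P := N) (Q := N) G (fun v : Site (d + 1) => (if v μ % (N : ℤ) = (N : ℤ) - 1 then (1 : ℝ) else 0))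
      (fun _ : Site (d + 1) => (1 : ℝ)) hGcov
      (fun v s => by simp only [Pi.add_apply, Pi.smul_apply, smul_eq_mul, Int.add_mul_emod_self_left]) (fun _ _ => rfl) hGa hGbs]
  refine Finset.sum_congr rfl fun x _ => ?_
  simp only [one_mul]
  -- Step 3: at the pairing site, the fibre sum comes out of the bond series and the bond series is the left two-face current
  have hLs : ∀ f : Fib d, Summable fun v : Site (d + 1) => (if v μ % (N : ℤ) = (N : ℤ) - 1 then (1 : ℝ) else 0) * (L v f (toSite x) * A f (toSite x)) := by
    intro f
    refine Summable.of_norm_bounded ((summable_exp_shift hδ (toSite x)).mul_left ((Cs * Zl (d + 1) δ) *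
      ((Fintype.card (Fib d) : ℝ) * (CX * (Cs * Zl (d + 1) (δ / 2) * Zl (d + 1) (δ / 2))) * Zl (d + 1) δ))) fun v => ?_
    rw [Real.norm_eq_abs, abs_mul, abs_mul]
    have h1 : |(if v μ % (N : ℤ) = (N : ℤ) - 1 then (1 : ℝ) else 0)| ≤ 1 := by split_ifs <;> simp
    have h0 : 0 ≤ (Fintype.card (Fib d) : ℝ) * (CX * (Cs * Zl (d + 1) (δ / 2) * Zl (d + 1) (δ / 2))) * Zl (d + 1) δ := by
      have := (Zl_pos (D := d + 1) (half_pos hδ)).le; have := (Zl_pos (D := d + 1) hδ).le; positivity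
    calc |(if v μ % (N : ℤ) = (N : ℤ) - 1 then (1 : ℝ) else 0)| * (|L v f (toSite x)| * |A f (toSite x)|)
        ≤ 1 * ((Cs * Zl (d + 1) δ * Real.exp (-δ * l1 (toSite x - v))) *
            ((Fintype.card (Fib d) : ℝ) * (CX * (Cs * Zl (d + 1) (δ / 2) * Zl (d + 1) (δ / 2))) * Zl (d + 1) δ)) :=
          mul_le_mul h1 (mul_le_mul (hLb v f (toSite x)) (hAb f (toSite x)) (abs_nonneg _) (by have := (Zl_pos (D := d + 1) hδ).le; positivity))
            (by positivity) zero_le_one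
      _ = _ := by ring
  have step3 : (∑' v : Site (d + 1), (if v μ % (N : ℤ) = (N : ℤ) - 1 then (1 : ℝ) else 0) * G v (toSite x)) =
      ∑ f : Fib d, (∑' v : Site (d + 1), (if v μ % (N : ℤ) = (N : ℤ) - 1 then (1 : ℝ) else 0) * L v f (toSite x)) * A f (toSite x) := by
    have e1 : ∀ v : Site (d + 1), (if v μ % (N : ℤ) = (N : ℤ) - 1 then (1 : ℝ) else 0) * G v (toSite x) =
        ∑ f : Fib d, (if v μ % (N : ℤ) = (N : ℤ) - 1 then (1 : ℝ) else 0) * (L v f (toSite x) * A f (toSite x)) := fun v => by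
      simp only [hGdef, Finset.mul_sum]
    rw [tsum_congr e1, Summable.tsum_finsetSum (fun f _ => hLs f)]
    refine Finset.sum_congr rfl fun f _ => ?_
    rw [← tsum_mul_right]
    exact tsum_congr fun v => by ring
  rw [step3]
  -- Step 4 (gen 57): the right current of `S` IS that of `S₁` (the `S₂`-current is null), in Part 42's spelling
  have hReq₁ : ∀ g z, R g z = ∑' w : Site (d + 1), (if w β % (N : ℤ) = (N : ℤ) - 1 then (1 : ℝ) else 0) *
      ∑' t : Site (d + 1), (if t ν % (N : ℤ) = (N : ℤ) - 1 then S₁ ν t z w g (Sum.inl β) else 0) := by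
    intro g z
    rw [hReq, faceR_add (N := N) hS₁ hS₂ hδ hsplit ν β z g (Sum.inl β), hnullR z g, add_zero]
  have hR₁inr : ∀ (m : Fin (d + 1)) z, R (Sum.inr m) z = 0 := fun m z => by
    rw [hReq₁]
    simp only [hS₁l, ite_self, tsum_zero, mul_zero]
  -- the left bond series of `S` IS that of `S₁`
  have hLeft : ∀ f : Fib d, (∑' v : Site (d + 1), (if v μ % (N : ℤ) = (N : ℤ) - 1 then (1 : ℝ) else 0) * L v f (toSite x)) =
      ∑' v : Site (d + 1), (if v μ % (N : ℤ) = (N : ℤ) - 1 then (1 : ℝ) else 0) *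
        ∑' y : Site (d + 1), (if y α % (N : ℤ) = (N : ℤ) - 1 then (1 : ℝ) else 0) * S₁ μ v y (toSite x) (Sum.inl α) f := by
    intro f
    have e : ∀ v : Site (d + 1), (if v μ % (N : ℤ) = (N : ℤ) - 1 then (1 : ℝ) else 0) * L v f (toSite x) =
        (if v μ % (N : ℤ) = (N : ℤ) - 1 then (1 : ℝ) else 0) * (∑' y : Site (d + 1), (if y α % (N : ℤ) = (N : ℤ) - 1 then (1 : ℝ) else 0) * S₁ μ v y (toSite x) (Sum.inl α) f) +
        (if v μ % (N : ℤ) = (N : ℤ) - 1 then (1 : ℝ) else 0) * (∑' y : Site (d + 1), (if y α % (N : ℤ) = (N : ℤ) - 1 then (1 : ℝ) else 0) * S₂ μ v y (toSite x) (Sum.inl α) f) := by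
      intro v
      simp only [hLdef]
      rw [leftCurrent_add (N := N) hS₁ hS₂ hδ hsplit μ α v (toSite x) f, mul_add]
    rw [tsum_congr e, (summable_chi_leftCurrent (N := N) hS₁ hδ μ α (toSite x) f).tsum_add (summable_chi_leftCurrent (N := N) hS₂ hδ μ α (toSite x) f),
      tsum_leftCurrent_eq_faceL (N := N) hS₂ hδ μ α (toSite x) f, hnullL (toSite x) f, add_zero]
  rw [Fintype.sum_sum_type]
  have hLinr : ∀ (m : Fin (d + 1)), (∑' v : Site (d + 1), (if v μ % (N : ℤ) = (N : ℤ) - 1 then (1 : ℝ) else 0) * L v (Sum.inr m) (toSite x)) = 0 := fun m => by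
    rw [hLeft]
    simp only [hS₁r, mul_zero, tsum_zero]
  simp only [hLinr, zero_mul, Finset.sum_const_zero, add_zero]
  refine Finset.sum_congr rfl fun a _ => ?_
  -- the left factor: `S₁`'s bond series, Fubini into its left two-face current
  rw [hLeft (Sum.inl a), tsum_leftCurrent_eq_faceL (N := N) hS₁ hδ μ α (toSite x) (Sum.inl a)]
  congr 1
  -- the right factor: fibre sum to field legs of `S₁`
  simp only [hAdef]
  refine tsum_congr fun z => ?_
  rw [Fintype.sum_sum_type]
  simp only [hR₁inr, mul_zero, Finset.sum_const_zero, add_zero]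
  exact Finset.sum_congr rfl fun b _ => by rw [hReq₁]

end Summit.QuantumFields.BalabanUV.Beta.GAN24.FaceWordNullSector

end
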